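/-
Copyright (c) 2026 the pub-hodgecm-mathlib formalisation cell (harness21).  Prover seat hodgecm-mathlib-K2E3-p03 (g4), Track B «K2-LIT» ∕ h413
(`stmt-HodgeConjecture-24833`), line `K2_E3_EllipticInputs`, unit U12, §L leaf (LBGL-ge3) at `N = 3` (Richardson road), brick R′ of the (F-E) road memo
`K2/K2E3-p11/g4/MEMO-FE-ParabolicSliceDensity.v1.K2E3-p11-g4.md` §2 (shared with the (F-J) census of K2E3-p17 (g6), §1 (vi)): THE NUMBER OF `F`-RATIONAL
ROOTS OF THE CHARACTERISTIC POLYNOMIAL OF A `3 × 3` MATRIX IS LOCALLY CONSTANT ON THE REGULAR SEMISIMPLE SET `{disc ≠ 0}` — PART 1: the perturbation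
toolkit (root bound, normalised strong Hensel, no new roots, persistence).  2026-09-04.
-/
import Summits.HodgeConjecture.HodgeConjecture.Theorems.K2E3StrongHenselValued     -- ★ p857249 (K2E4-p13 g3): `exists_isRoot_of_valuation_eval_lt_sq_of_forall_coeff` (strong Hensel at the level of `K`)
import Literature.LinearAlgebra.Matrix.RegularSemisimpleConjClassClosed              -- ★ `continuous_charpoly_coeff` (coefficients of `χ_M` are continuous in `M`)
import Literature.FieldTheory.FiniteFields.AdditiveAndFqLinearPolynomials            -- ★ `coeff_comp_C_mul_X` (`coeff_n P(cx) = cⁿ · coeff_n P`)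
import Mathlib.RingTheory.Polynomial.Resultant.Basic
import Mathlib.FieldTheory.Separable
import HarnessLib

/-!
# K2_E3 road (h413), §L leaf (LBGL-ge3) at `N = 3`, brick R′ (part 1 of 2) — perturbation toolkit for the rational roots of `χ_Y`, `Y` near `X₀`

Cell `pub/hodgecm-mathlib` (D-0151), Track B (21-frontier RULING «PUSH BOTH» 2026-09-03, director req624), seat K2E3-p03 (g4) (free E3 hand; brick R′
«HAND WANTED #3» of the Richardson road owner K2E3-p11 (g4)'s (F-E) memo `K2/K2E3-p11/g4/MEMO-FE-ParabolicSliceDensity.v1.K2E3-p11-g4.md` §2, hand-over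
05:24:02Z «R′ UNOWNED → pool»; ALSO serves K2E3-p17 (g6)'s (F-J) census §1 (vi) «𝔤′ is open AND closed in 𝔤^{rs}»; dealer K2E3-plan (g3)).
`--supports stmt-HodgeConjecture-24833 --as helper`; THEOREMS ONLY (no definition ∕ instance ∕ notation ∕ named fact ∕ `sorry`); never imports `Cruxes/…/Lines`.
COUNT-NEUTRAL.  This is PART 1 (general `m × m` matrices, general degree): the algebra ∕ valuation ∕ topology toolkit; PART 2
`K2E3CubicRationalRootsLocallyConstant` does the count for `3 × 3` matrices.

CONTENTS (`F` ANY non-archimedean local field — no restriction on the (residue) characteristic; `v` the valuation of the valuative relation; `χ_Y` the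
characteristic polynomial of `Y ∈ 𝔤𝔩_m(F)`).  §1 (any field): `separable_of_discr_ne_zero` (`disc f ≠ 0 ⇒ f` separable, monic `f`: Mathlib `resultant_deriv` +
`exists_mul_add_mul_eq_C_resultant`); `card_roots_ne_two_of_natDegree_eq_three`.  §2 (local field): `valuation_le_of_isRoot` — the
ULTRAMETRIC ROOT BOUND; **`exists_isRoot_of_valuation_eval_mul_lt`** — the NORMALISED strong Hensel ∕ Newton step for an ARBITRARY `f ∈ F[X]` and base point
(scale `s`, normaliser `c`; ★ `K2E3StrongHenselValued.exists_isRoot_of_valuation_eval_lt_sq_of_forall_coeff` on `C c⁻¹ · f ∘ (s·X)` at `a₀ ∕ s`), sharp Newton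
distance `v(a − a₀) · v(f′(a₀)) = v(f(a₀))`.  §3 (matrix families): joint continuity of `(Y, x) ↦ χ_Y(x), χ_Y′(x)` (★ `continuous_charpoly_coeff`); coefficient
bound near `X₀`; **`eventually_forall_isRoot_mem`** — NO NEW ROOTS (roots stay in the compact ball `{v ≤ M}` ★ `IsNonarchimedeanLocalField.isCompact_closedBall`;
`χ_Y ≠ 0` on its compact part outside `U` by the generalized tube lemma `IsCompact.eventually_forall_of_forall_eventually`); derivative valuations locally
constant (`Valuation.locally_const`); **`eventually_exists_isRoot_valuation_sub_lt`** — PERSISTENCE of simple rational roots within any prescribed radius.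
[Cassels1986, Ch. 4 §3 Lemma 3.1, Cor. 1 (strong Hensel), Cor. 2 (continuity of roots); Serre1979, Ch. II §2; HarishChandra1999AdmissibleDistributions, §7]
HONEST LABEL: HC_CM is proved only modulo the 7 printed citations (2 remaining named inputs: hLiu418 = stmt-HodgeConjecture-24832, h413 =
stmt-HodgeConjecture-24833) until rung 0 closes; count-neutral helper.

## References
* [Cassels1986] J. W. S. Cassels, *Local Fields*, LMS Student Texts 3 (1986), Ch. 4 §3 Lemma 3.1, Cor. 1, Cor. 2. [Serre1979] J.-P. Serre, *Local Fields*, GTM 67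
  (1979), Ch. II §2. [HarishChandra1999AdmissibleDistributions] Harish-Chandra (DeBacker–Sally), *Admissible Invariant Distributions …* (1999), §7.
-/

set_option autoImplicit false
set_option linter.dupNamespace false   -- `Summit.HodgeConjecture.HodgeConjecture.…` (D-0017 nested layout; lakefile exemption for Summits)

noncomputable section
open Filter Topology Set Polynomial
open scoped Matrix
open ValuativeRel
open Summit.HodgeConjecture.HodgeConjecture.Cruxes.H413.K2E3StrongHenselValued
namespace Summit.HodgeConjecture.HodgeConjecture.Cruxes.H413.K2E3CharpolyRootsPerturbation

/-! ## §1  Polynomial algebra over a field: separability from the discriminant; a monic cubic never has exactly two rational roots -/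
section FieldAlgebra

variable {K : Type*} [Field K]

/-- **`disc f ≠ 0 ⇒ f` separable** (monic `f` of positive degree): the Sylvester identity `f·p + f′·q = C (Res(f, f′))` (Mathlib
`exists_mul_add_mul_eq_C_resultant`) with `Res(f, f′) = ± lc(f) · disc f` (`resultant_deriv`). [cite: Cassels1986, Ch. 4 §3] -/
theorem separable_of_discr_ne_zero {f : K[X]} (hf : f.Monic) (hdeg : 0 < f.natDegree) (hd : f.discr ≠ 0) : f.Separable := by
  have hdeg' : 0 < f.degree := natDegree_pos_iff_degree_pos.1 hdeg
  obtain ⟨p, q, -, -, hpq⟩ := exists_mul_add_mul_eq_C_resultant f f.derivative (m := f.natDegree) (n := f.natDegree - 1) le_rfl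
    (natDegree_derivative_le f) (Or.inl hdeg.ne')
  set r := f.resultant f.derivative f.natDegree (f.natDegree - 1) with hr
  have hr0 : r ≠ 0 := by
    rw [hr, resultant_deriv hdeg', hf.leadingCoeff, mul_one]
    exact mul_ne_zero (pow_ne_zero _ (neg_ne_zero.2 one_ne_zero)) hd
  rw [separable_def']
  refine ⟨C r⁻¹ * p, C r⁻¹ * q, ?_⟩
  calc C r⁻¹ * p * f + C r⁻¹ * q * f.derivative = C r⁻¹ * (f * p + f.derivative * q) := by ring
    _ = 1 := by rw [hpq, ← C_mul, inv_mul_cancel₀ hr0, C_1]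

/-- **A monic cubic over a field never has exactly two rational roots** (counted with multiplicity): dividing out two linear factors leaves a linear
factor, which has a root. [folklore] -/
theorem card_roots_ne_two_of_natDegree_eq_three {f : K[X]} (hdeg : f.natDegree = 3) : f.roots.card ≠ 2 := by
  intro h2
  obtain ⟨q, hprod, hcard, hq⟩ := exists_prod_multiset_X_sub_C_mul f
  rw [h2, hdeg] at hcard
  have hq1 : q.natDegree = 1 := by omega
  have hq0 : q ≠ 0 := by
    intro h0
    rw [h0, natDegree_zero] at hq1
    exact zero_ne_one hq1
  obtain ⟨x, hx⟩ := exists_root_of_degree_eq_one ((degree_eq_iff_natDegree_eq hq0).2 hq1)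
  have hmem : x ∈ q.roots := (mem_roots hq0).2 hx
  rw [hq] at hmem
  exact Multiset.notMem_zero x hmem

end FieldAlgebra

/-! ## §2  Valuation toolkit over a non-archimedean local field: the root bound and the normalised strong Hensel step -/
section LocalField

variable {F : Type*} [Field F] [ValuativeRel F] [TopologicalSpace F] [IsNonarchimedeanLocalField F]

omit [TopologicalSpace F] [IsNonarchimedeanLocalField F] in
/-- **Ultrametric root bound**: a root `μ` of a MONIC polynomial whose lower coefficients have valuation `≤ M` (`M ≥ 1`) has `v μ ≤ M`
(otherwise `μⁿ` strictly dominates every other term of `f(μ) = 0`). [cite: Cassels1986, Ch. 4 §3] -/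
theorem valuation_le_of_isRoot {f : F[X]} (hf : f.Monic) {M : ValueGroupWithZero F} (hM : 1 ≤ M)
    (hc : ∀ i, i < f.natDegree → valuation F (f.coeff i) ≤ M) {μ : F} (hμ : f.IsRoot μ) : valuation F μ ≤ M := by
  by_contra hlt
  rw [not_le] at hlt
  have h1 : 1 < valuation F μ := lt_of_le_of_lt hM hlt
  have hμ0 : valuation F μ ≠ 0 := ne_of_gt (lt_trans zero_lt_one h1)
  set n := f.natDegree with hn
  -- `μ ^ n = - Σ_{i < n} c_i μ^i`
  have heval : f.eval μ = (∑ i ∈ Finset.range n, f.coeff i * μ ^ i) + μ ^ n := by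
    rw [eval_eq_sum_range, Finset.sum_range_succ, ← hn, hf.coeff_natDegree, one_mul]
  have hroot : μ ^ n = -∑ i ∈ Finset.range n, f.coeff i * μ ^ i := by
    have h0 : f.eval μ = 0 := hμ
    rw [heval] at h0
    exact eq_neg_of_add_eq_zero_right h0
  -- every term of the sum is `< v μ ^ n`
  have hlt' : valuation F (∑ i ∈ Finset.range n, f.coeff i * μ ^ i) < valuation F μ ^ n := by
    refine Valuation.map_sum_lt _ (pow_ne_zero _ hμ0) fun i hi => ?_
    rw [Finset.mem_range] at hi
    rw [map_mul, map_pow]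
    calc valuation F (f.coeff i) * valuation F μ ^ i ≤ M * valuation F μ ^ i :=
          mul_le_mul_of_nonneg_right (hc i hi) zero_le
      _ < valuation F μ * valuation F μ ^ i := mul_lt_mul_of_pos_right hlt (pow_pos (lt_trans zero_lt_one h1) _)
      _ = valuation F μ ^ (i + 1) := by rw [pow_succ']
      _ ≤ valuation F μ ^ n := pow_le_pow_right₀ h1.le (by omega)
  have := congrArg (valuation F) hroot
  rw [Valuation.map_neg, map_pow] at this
  exact (ne_of_gt hlt') this

/-- **Normalised strong Hensel ∕ Newton step** for an ARBITRARY `f ∈ F[X]` and base point `a₀` (no integrality): given a scale `s` (`v s ≥ 1`, `v a₀ ≤ v s`) and a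
normaliser `c` (`v c ≥ 1`, `v(f.coeff i) · (v s)^i ≤ v c` for all `i`), if `v(f(a₀)) · v c < (v s)² · v(f′(a₀))²` then `f` has a root `a ∈ F` with the SHARP
Newton distance `v(a − a₀) · v(f′(a₀)) = v(f(a₀))` — ★ `exists_isRoot_of_valuation_eval_lt_sq_of_forall_coeff` applied to the integral polynomial
`p := C c⁻¹ · f ∘ (s·X)` at the integral point `a₀ ∕ s`. [cite: Cassels1986, Ch. 4 §3 Lemma 3.1 and Cor. 1 pp. 49–50] -/
theorem exists_isRoot_of_valuation_eval_mul_lt (f : F[X]) {a₀ s c : F} (hs : 1 ≤ valuation F s) (ha₀ : valuation F a₀ ≤ valuation F s)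
    (hc : 1 ≤ valuation F c) (hcoef : ∀ i, valuation F (f.coeff i) * valuation F s ^ i ≤ valuation F c)
    (h : valuation F (f.eval a₀) * valuation F c < valuation F s ^ 2 * valuation F (f.derivative.eval a₀) ^ 2) :
    ∃ a : F, f.IsRoot a ∧ valuation F (a - a₀) * valuation F (f.derivative.eval a₀) = valuation F (f.eval a₀) := by
  have hvs0 : valuation F s ≠ 0 := ne_of_gt (lt_of_lt_of_le zero_lt_one hs)
  have hvc0 : valuation F c ≠ 0 := ne_of_gt (lt_of_lt_of_le zero_lt_one hc)
  have hs0 : s ≠ 0 := fun h0 => hvs0 (by rw [h0, map_zero])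
  have hc0 : c ≠ 0 := fun h0 => hvc0 (by rw [h0, map_zero])
  -- the normalised polynomial and base point
  set p : F[X] := C c⁻¹ * f.comp (C s * X) with hp
  set b₀ : F := s⁻¹ * a₀ with hb₀
  have hpcoeff : ∀ n, valuation F (p.coeff n) ≤ 1 := by
    intro n
    rw [hp, coeff_C_mul, Literature.FieldTheory.FiniteFields.AdditiveAndFqLinearPolynomials.coeff_comp_C_mul_X, map_mul, map_mul, map_pow, map_inv₀]
    calc (valuation F c)⁻¹ * (valuation F (f.coeff n) * valuation F s ^ n) ≤ (valuation F c)⁻¹ * valuation F c :=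
          mul_le_mul_of_nonneg_left (hcoef n) zero_le
      _ = 1 := inv_mul_cancel₀ hvc0
  have hb₀v : valuation F b₀ ≤ 1 := by
    rw [hb₀, map_mul, map_inv₀]
    calc (valuation F s)⁻¹ * valuation F a₀ ≤ (valuation F s)⁻¹ * valuation F s := mul_le_mul_of_nonneg_left ha₀ zero_le
      _ = 1 := inv_mul_cancel₀ hvs0
  have hsb₀ : s * b₀ = a₀ := by rw [hb₀, mul_inv_cancel_left₀ hs0]
  have hpev : p.eval b₀ = c⁻¹ * f.eval a₀ := by
    rw [hp, eval_mul, eval_C, eval_comp, eval_mul, eval_C, eval_X, hsb₀]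
  have hpder : p.derivative.eval b₀ = c⁻¹ * (s * f.derivative.eval a₀) := by
    rw [hp, derivative_C_mul, derivative_comp, derivative_C_mul_X, eval_mul, eval_C, eval_mul, eval_C, eval_comp, eval_mul, eval_C,
      eval_X, hsb₀]
  have hvpev : valuation F (p.eval b₀) = (valuation F c)⁻¹ * valuation F (f.eval a₀) := by rw [hpev, map_mul, map_inv₀]
  have hvpder : valuation F (p.derivative.eval b₀) = (valuation F c)⁻¹ * (valuation F s * valuation F (f.derivative.eval a₀)) := by
    rw [hpder, map_mul, map_mul, map_inv₀]
  -- the Hensel hypothesis for `p` at `b₀`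
  have hH : valuation F (p.eval b₀) < valuation F (p.derivative.eval b₀) ^ 2 := by
    rw [hvpev, hvpder]
    have hci : (0 : ValueGroupWithZero F) < (valuation F c)⁻¹ := inv_pos.2 (lt_of_lt_of_le zero_lt_one hc)
    have key : (valuation F c)⁻¹ * valuation F (f.eval a₀) =
        (valuation F c)⁻¹ ^ 2 * (valuation F (f.eval a₀) * valuation F c) := by
      rw [pow_two, mul_assoc, mul_comm (valuation F (f.eval a₀)) (valuation F c), ← mul_assoc ((valuation F c)⁻¹) (valuation F c),
        inv_mul_cancel₀ hvc0, one_mul]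
    rw [key, mul_pow, mul_pow]
    exact mul_lt_mul_of_pos_left h (pow_pos hci 2)
  obtain ⟨a, ha, -, hdist, -⟩ := exists_isRoot_of_valuation_eval_lt_sq_of_forall_coeff p hpcoeff hb₀v hH
  refine ⟨s * a, ?_, ?_⟩
  · -- `f (s a) = c · p(a) = 0`
    have hpa : p.eval a = 0 := ha
    rw [hp, eval_mul, eval_C, eval_comp, eval_mul, eval_C, eval_X] at hpa
    rcases mul_eq_zero.1 hpa with h0 | h0
    · exact absurd h0 (inv_ne_zero hc0)
    · exact h0
  · -- transport the sharp Newton distance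
    have hsa : s * a - a₀ = s * (a - b₀) := by rw [mul_sub, hsb₀]
    rw [hvpev, hvpder] at hdist
    rw [hsa, map_mul]
    have hci0 : (valuation F c)⁻¹ ≠ 0 := inv_ne_zero hvc0
    have hdist' : (valuation F c)⁻¹ * (valuation F s * valuation F (a - b₀) * valuation F (f.derivative.eval a₀)) =
        (valuation F c)⁻¹ * valuation F (f.eval a₀) := by
      rw [← hdist]; ac_rfl
    exact mul_left_cancel₀ hci0 hdist'

end LocalField

/-! ## §3  Matrix families `Y ↦ χ_Y` over a non-archimedean local field: joint continuity, coefficient bound, no new roots, derivative valuations, persistence -/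
section MatrixGlue

variable {F : Type*} [Field F] [ValuativeRel F] [TopologicalSpace F] [IsNonarchimedeanLocalField F]
  {m : Type*} [Fintype m] [DecidableEq m]

/-- `(Y, x) ↦ χ_Y(x)` is jointly continuous (a polynomial in the entries of `Y` and in `x`; ★ `continuous_charpoly_coeff`). [folklore] -/
theorem continuous_eval_charpoly : Continuous fun p : Matrix m m F × F => p.1.charpoly.eval p.2 := by
  have h : (fun p : Matrix m m F × F => p.1.charpoly.eval p.2) =
      fun p : Matrix m m F × F => ∑ i ∈ Finset.range (Fintype.card m + 1), p.1.charpoly.coeff i * p.2 ^ i := by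
    funext p
    exact eval_eq_sum_range' (lt_of_le_of_lt (Matrix.charpoly_natDegree_eq_dim p.1).le (Nat.lt_succ_self _)) p.2
  rw [h]
  refine continuous_finsetSum _ fun i _ => ?_
  exact ((Literature.LinearAlgebra.Matrix.continuous_charpoly_coeff i).comp continuous_fst).mul ((continuous_pow i).comp continuous_snd)

/-- `(Y, x) ↦ χ_Y′(x)` is jointly continuous. [folklore] -/
theorem continuous_eval_derivative_charpoly : Continuous fun p : Matrix m m F × F => p.1.charpoly.derivative.eval p.2 := by
  have h : (fun p : Matrix m m F × F => p.1.charpoly.derivative.eval p.2) =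
      fun p : Matrix m m F × F => ∑ i ∈ Finset.range (Fintype.card m + 1), (p.1.charpoly.coeff (i + 1) * ((i : F) + 1)) * p.2 ^ i := by
    funext p
    rw [eval_eq_sum_range' (n := Fintype.card m + 1)]
    · simp only [coeff_derivative]
    · exact lt_of_le_of_lt ((natDegree_derivative_le _).trans (Nat.sub_le _ _))
        (by rw [Matrix.charpoly_natDegree_eq_dim]; exact Nat.lt_succ_self _)
  rw [h]
  refine continuous_finsetSum _ fun i _ => ?_
  exact (((Literature.LinearAlgebra.Matrix.continuous_charpoly_coeff (i + 1)).comp continuous_fst).mul continuous_const).mul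
    ((continuous_pow i).comp continuous_snd)

omit [TopologicalSpace F] [IsNonarchimedeanLocalField F] in
/-- A common bound `M ≥ 1` for the valuations of the coefficients of a polynomial. [folklore] -/
theorem exists_one_le_forall_valuation_coeff_le (f : F[X]) : ∃ M : ValueGroupWithZero F, 1 ≤ M ∧ ∀ i, valuation F (f.coeff i) ≤ M := by
  classical
  obtain ⟨i₀, -, hi₀⟩ := (Finset.range (f.natDegree + 1)).exists_max_image (fun i => valuation F (f.coeff i)) ⟨0, by simp⟩
  refine ⟨max 1 (valuation F (f.coeff i₀)), le_max_left _ _, fun i => ?_⟩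
  by_cases hi : i < f.natDegree + 1
  · exact (hi₀ i (Finset.mem_range.2 hi)).trans (le_max_right _ _)
  · rw [coeff_eq_zero_of_natDegree_lt (by omega), map_zero]
    exact zero_le

/-- **Coefficient bound near `X₀`**: a bound `M ≠ 0` for the valuations of the coefficients of `χ_{X₀}` bounds those of `χ_Y` for `Y` near `X₀` (ultrametric;
★ `continuous_charpoly_coeff`). [folklore] -/
theorem eventually_forall_valuation_coeff_charpoly_le (X₀ : Matrix m m F) {M : ValueGroupWithZero F} (hM : M ≠ 0)
    (hc : ∀ i, valuation F (X₀.charpoly.coeff i) ≤ M) :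
    ∀ᶠ Y in 𝓝 X₀, ∀ i, valuation F (Y.charpoly.coeff i) ≤ M := by
  have hfin : ∀ i ∈ Finset.range (Fintype.card m + 1), ∀ᶠ Y in 𝓝 X₀, valuation F (Y.charpoly.coeff i) ≤ M := by
    intro i _
    have hcont : ContinuousAt (fun Y : Matrix m m F => Y.charpoly.coeff i) X₀ :=
      (Literature.LinearAlgebra.Matrix.continuous_charpoly_coeff i).continuousAt
    have hball : {z : F | valuation F (z - X₀.charpoly.coeff i) < (Units.mk0 M hM : (ValueGroupWithZero F)ˣ)} ∈ 𝓝 (X₀.charpoly.coeff i) :=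
      (IsValuativeTopology.hasBasis_nhds _).mem_of_mem trivial
    filter_upwards [hcont.preimage_mem_nhds hball] with Y hY
    have hY' : valuation F (Y.charpoly.coeff i - X₀.charpoly.coeff i) < M := hY
    calc valuation F (Y.charpoly.coeff i) = valuation F (X₀.charpoly.coeff i + (Y.charpoly.coeff i - X₀.charpoly.coeff i)) := by
          rw [add_sub_cancel]
      _ ≤ max (valuation F (X₀.charpoly.coeff i)) (valuation F (Y.charpoly.coeff i - X₀.charpoly.coeff i)) := Valuation.map_add _ _ _
      _ ≤ M := max_le (hc i) hY'.le
  filter_upwards [(Filter.eventually_all_finset _).2 hfin] with Y hY i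
  by_cases hi : i < Fintype.card m + 1
  · exact hY i (Finset.mem_range.2 hi)
  · rw [coeff_eq_zero_of_natDegree_lt (by rw [Matrix.charpoly_natDegree_eq_dim]; omega), map_zero]
    exact zero_le

/-- **NO NEW ROOTS** (topological): if an open `U ⊆ F` contains every rational root of `χ_{X₀}`, then for `Y` near `X₀` every rational root of `χ_Y` lies in `U`
— the roots stay in the compact ball `{v ≤ M}` (root bound), on whose compact part outside `U` the jointly continuous `(Y, x) ↦ χ_Y(x)` stays non-zero
(generalized tube lemma). [cite: Cassels1986, Ch. 4 §3 Cor. 2] -/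
theorem eventually_forall_isRoot_mem (X₀ : Matrix m m F) {U : Set F} (hU : IsOpen U) (hroots : ∀ x, X₀.charpoly.IsRoot x → x ∈ U) :
    ∀ᶠ Y in 𝓝 X₀, ∀ μ, Y.charpoly.IsRoot μ → μ ∈ U := by
  haveI : T2Space F := (Literature.NumberTheory.GaloisRepresentations.IsNonarchimedeanLocalField.isLocalField F).toT2Space
  obtain ⟨M, hM1, hMc⟩ := exists_one_le_forall_valuation_coeff_le X₀.charpoly
  have hM0 : M ≠ 0 := ne_of_gt (lt_of_lt_of_le zero_lt_one hM1)
  have hK : IsCompact ({x : F | valuation F x ≤ M} \ U) := (IsNonarchimedeanLocalField.isCompact_closedBall F M).diff hU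
  have htube : ∀ᶠ Y in 𝓝 X₀, ∀ y ∈ {x : F | valuation F x ≤ M} \ U, Y.charpoly.eval y ≠ 0 := by
    refine hK.eventually_forall_of_forall_eventually fun y hy => ?_
    have hy0 : X₀.charpoly.eval y ≠ 0 := fun h0 => hy.2 (hroots y h0)
    exact (continuous_eval_charpoly.continuousAt (x := (X₀, y))).eventually_ne hy0
  filter_upwards [htube, eventually_forall_valuation_coeff_charpoly_le X₀ hM0 hMc] with Y hY hYc μ hμ
  by_contra hμU
  exact hY μ ⟨valuation_le_of_isRoot (Matrix.charpoly_monic Y) hM1 (fun i _ => hYc i) hμ, hμU⟩ hμ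

/-- **Derivative valuations are locally constant**: if `χ_{X₀}′(λ₀) ≠ 0` there is a radius `ρ` such that `v(χ_Y′(x)) = v(χ_{X₀}′(λ₀))` for `Y` near `X₀` and
`v(x − λ₀) < ρ` (joint continuity + `Valuation.locally_const`). [folklore] -/
theorem exists_eventually_forall_valuation_derivative_eval_eq (X₀ : Matrix m m F) {a : F} (hδ : X₀.charpoly.derivative.eval a ≠ 0) :
    ∃ ρ : (ValueGroupWithZero F)ˣ, ∀ᶠ Y in 𝓝 X₀, ∀ x, valuation F (x - a) < ρ →
      valuation F (Y.charpoly.derivative.eval x) = valuation F (X₀.charpoly.derivative.eval a) := by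
  have hne : valuation F ((fun p : Matrix m m F × F => p.1.charpoly.derivative.eval p.2) (X₀, a)) ≠ 0 := (Valuation.ne_zero_iff _).2 hδ
  have hpre := (continuous_eval_derivative_charpoly (F := F) (m := m)).continuousAt.preimage_mem_nhds ((valuation F).locally_const hne)
  obtain ⟨V, hV, W, hW, hVW⟩ := mem_nhds_prod_iff.1 hpre
  obtain ⟨ρ, -, hρ⟩ := (IsValuativeTopology.hasBasis_nhds a).mem_iff.1 hW
  refine ⟨ρ, ?_⟩
  filter_upwards [hV] with Y hY x hx
  exact hVW (Set.mk_mem_prod hY (hρ hx))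

omit [TopologicalSpace F] [IsNonarchimedeanLocalField F] [Fintype m] [DecidableEq m] in
/-- A lower bound for finitely many positive elements of the value group. [folklore] -/
theorem exists_units_le_of_finset {ι : Type*} (t : Finset ι) (g : ι → (ValueGroupWithZero F)ˣ) : ∃ ρ : (ValueGroupWithZero F)ˣ, ∀ i ∈ t, ρ ≤ g i := by
  classical
  induction t using Finset.induction_on with
  | empty => exact ⟨1, fun i hi => absurd hi (Finset.notMem_empty i)⟩
  | insert a t _ ih =>
    obtain ⟨ρ, hρ⟩ := ih
    refine ⟨min (g a) ρ, fun i hi => ?_⟩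
    rcases Finset.mem_insert.1 hi with rfl | hi
    · exact min_le_left _ _
    · exact (min_le_right _ _).trans (hρ i hi)

omit [TopologicalSpace F] [IsNonarchimedeanLocalField F] in
/-- Ultrametric triangle: two points `ρ`-close to `b` are `ρ`-close to each other. [folklore] -/
theorem valuation_sub_lt_of_lt_of_lt {a b c : F} {ρ : ValueGroupWithZero F} (h₁ : valuation F (a - b) < ρ) (h₂ : valuation F (c - b) < ρ) :
    valuation F (a - c) < ρ := by
  rw [← sub_add_sub_cancel a b c]
  exact Valuation.map_add_lt _ h₁ (by rwa [Valuation.map_sub_swap])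

omit [IsNonarchimedeanLocalField F] in
/-- Open valuation balls `{x | v(x − a) < ρ}` are open. [folklore] -/
theorem isOpen_setOf_valuation_sub_lt [IsValuativeTopology F] (a : F) (ρ : (ValueGroupWithZero F)ˣ) :
    IsOpen {x : F | valuation F (x - a) < ρ} := by
  rw [isOpen_iff_mem_nhds]
  intro x hx
  exact Filter.mem_of_superset ((IsValuativeTopology.hasBasis_nhds x).mem_of_mem (i := ρ) trivial)
    fun y hy => valuation_sub_lt_of_lt_of_lt hy (by rw [Valuation.map_sub_swap]; exact hx)

/-- **PERSISTENCE of simple rational roots**: if `λ₀` is a rational root of `χ_{X₀}` with `χ_{X₀}′(λ₀) ≠ 0`, then for `Y` near `X₀` the polynomial `χ_Y` has a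
rational root `ρ`-close to `λ₀`, for every radius `ρ` (normalised strong Hensel ★ at `λ₀`: `v(χ_Y(λ₀)) → 0`, `v(χ_Y′(λ₀)) = v(χ_{X₀}′(λ₀))`, coefficients bounded).
[cite: Cassels1986, Ch. 4 §3 Lemma 3.1, Cor. 1, Cor. 2] -/
theorem eventually_exists_isRoot_valuation_sub_lt (X₀ : Matrix m m F) {a : F} (ha : X₀.charpoly.IsRoot a)
    (hδ : X₀.charpoly.derivative.eval a ≠ 0) (ρ : (ValueGroupWithZero F)ˣ) :
    ∀ᶠ Y in 𝓝 X₀, ∃ μ, Y.charpoly.IsRoot μ ∧ valuation F (μ - a) < ρ := by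
  obtain ⟨M, hM1, hMc⟩ := exists_one_le_forall_valuation_coeff_le X₀.charpoly
  have hMpos : 0 < M := lt_of_lt_of_le zero_lt_one hM1
  have hM0 : M ≠ 0 := ne_of_gt hMpos
  set d := Fintype.card m with hd
  set δ := valuation F (X₀.charpoly.derivative.eval a) with hδdef
  have hδ0 : δ ≠ 0 := (Valuation.ne_zero_iff _).2 hδ
  have hδpos : 0 < δ := zero_lt_iff.2 hδ0
  have haM : valuation F a ≤ M := valuation_le_of_isRoot (Matrix.charpoly_monic X₀) hM1 (fun i _ => hMc i) ha
  obtain ⟨s, hs⟩ := valuation_surjective (M : ValueGroupWithZero F)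
  obtain ⟨c, hc⟩ := valuation_surjective (M ^ (d + 1) : ValueGroupWithZero F)
  -- (A) coefficients of `χ_Y` bounded by `M`
  have hA := eventually_forall_valuation_coeff_charpoly_le X₀ hM0 hMc
  -- (B) `v(χ_Y′(a)) = δ`
  have hB : ∀ᶠ Y in 𝓝 X₀, valuation F (Y.charpoly.derivative.eval a) = δ := by
    have hcont : ContinuousAt (fun Y : Matrix m m F => Y.charpoly.derivative.eval a) X₀ :=
      (continuous_eval_derivative_charpoly.comp (Continuous.prodMk_left a)).continuousAt
    filter_upwards [hcont.preimage_mem_nhds ((valuation F).locally_const (x := X₀.charpoly.derivative.eval a) hδ0)] with Y hY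
    exact hY
  -- (C) `v(χ_Y(a))` arbitrarily small
  have hC : ∀ γ : (ValueGroupWithZero F)ˣ, ∀ᶠ Y in 𝓝 X₀, valuation F (Y.charpoly.eval a) < γ := by
    intro γ
    have hcont : ContinuousAt (fun Y : Matrix m m F => Y.charpoly.eval a) X₀ :=
      (continuous_eval_charpoly.comp (Continuous.prodMk_left a)).continuousAt
    have h0 : X₀.charpoly.eval a = 0 := ha
    have hball : {z : F | valuation F (z - X₀.charpoly.eval a) < γ} ∈ 𝓝 (X₀.charpoly.eval a) :=
      (IsValuativeTopology.hasBasis_nhds _).mem_of_mem trivial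
    filter_upwards [hcont.preimage_mem_nhds hball] with Y hY
    have hY' : valuation F (Y.charpoly.eval a - X₀.charpoly.eval a) < γ := hY
    rwa [h0, sub_zero] at hY'
  -- the threshold
  obtain ⟨ε, hε0, hε1⟩ := IsNontrivial.exists_lt_one (R := F)
  set γ₁ : ValueGroupWithZero F := ε * (M ^ 2 * δ ^ 2) * (M ^ (d + 1))⁻¹ with hγ₁
  set γ₂ : ValueGroupWithZero F := (ρ : ValueGroupWithZero F) * δ with hγ₂
  have hγ₁0 : γ₁ ≠ 0 := mul_ne_zero (mul_ne_zero (ne_of_gt hε0) (mul_ne_zero (pow_ne_zero _ hM0) (pow_ne_zero _ hδ0)))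
    (inv_ne_zero (pow_ne_zero _ hM0))
  have hγ₂0 : γ₂ ≠ 0 := mul_ne_zero ρ.ne_zero hδ0
  have hγ0 : min γ₁ γ₂ ≠ 0 := by rcases min_choice γ₁ γ₂ with h | h <;> rw [h] <;> assumption
  filter_upwards [hA, hB, hC (Units.mk0 _ hγ0)] with Y hYA hYB hYC
  have hYC' : valuation F (Y.charpoly.eval a) < min γ₁ γ₂ := hYC
  -- the normalised Hensel step at `a`
  have hcoef : ∀ i, valuation F (Y.charpoly.coeff i) * valuation F s ^ i ≤ valuation F c := by
    intro i
    rw [hs, hc]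
    by_cases hi : i ≤ d
    · calc valuation F (Y.charpoly.coeff i) * M ^ i ≤ M * M ^ d := mul_le_mul (hYA i) (pow_le_pow_right₀ hM1 hi) zero_le zero_le
        _ = M ^ (d + 1) := by rw [pow_succ']
    · rw [coeff_eq_zero_of_natDegree_lt (by rw [Matrix.charpoly_natDegree_eq_dim]; omega), map_zero, zero_mul]
      exact zero_le
  have hH : valuation F (Y.charpoly.eval a) * valuation F c < valuation F s ^ 2 * valuation F (Y.charpoly.derivative.eval a) ^ 2 := by
    rw [hc, hs, hYB]
    calc valuation F (Y.charpoly.eval a) * M ^ (d + 1) < γ₁ * M ^ (d + 1) :=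
          mul_lt_mul_of_pos_right (lt_of_lt_of_le hYC' (min_le_left _ _)) (pow_pos hMpos _)
      _ = ε * (M ^ 2 * δ ^ 2) := by rw [hγ₁, inv_mul_cancel_right₀ (pow_ne_zero _ hM0)]
      _ < M ^ 2 * δ ^ 2 := mul_lt_of_lt_one_left (mul_pos (pow_pos hMpos _) (pow_pos hδpos _)) hε1
  obtain ⟨μ, hμ, hdist⟩ := exists_isRoot_of_valuation_eval_mul_lt Y.charpoly (a₀ := a) (s := s) (c := c) (by rw [hs]; exact hM1)
    (by rw [hs]; exact haM) (by rw [hc]; exact one_le_pow₀ hM1) hcoef hH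
  refine ⟨μ, hμ, ?_⟩
  rw [hYB] at hdist
  have hlt : valuation F (μ - a) * δ < (ρ : ValueGroupWithZero F) * δ := by
    rw [hdist]; exact lt_of_lt_of_le hYC' (min_le_right _ _)
  exact lt_of_mul_lt_mul_right hlt zero_le

end MatrixGlue

end Summit.HodgeConjecture.HodgeConjecture.Cruxes.H413.K2E3CharpolyRootsPerturbation

end
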